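import Summits.QuantumFields.BalabanUV.T4Continuum.Support.NE9FutureProfileRecordPrelim
import Summits.QuantumFields.BalabanUV.T4Continuum.Support.NE9ChannelReadingSharp

/-!
# NE9FutureProfileEndOfRecordSharp — route R4's END OF RECORD for an ARBITRARY reading constant `τ₀`, and the `√2`-FREE instance:
# `NE9 ∧ FadingMemory` at the Earle–Hamilton rate `2θ∕(1+θ)` under the ROOM `ω̂·r + τ̄·B₀ ≤ θ·r` (the tree END's room has `√2·τ̄`)

Cell `pub-balaban`, T4-DAG §6 NE9; NE9 crux team (coordinator ruling «YM REDIRECT» e34b3e0c (2)); leaf lineage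
`b2b-balaban-t4-ne9-formalise-leaf-05` generation 46; route R4 «fading by Earle–Hamilton» of `t4/ROUTES-NE9.md` v6.  SIBLING of the
OWNER's END OF RECORD `NE9FutureProfileEndOfRecord` (lineage `b2b-balaban-t4-ne9-p1` gen 60: `orbit_of_record`,
`ne9_and_fadingMemory_of_holoSlice`, room `ω̂·r + (√2·τ̄)·B₀ ≤ θ·r`, injection `JRec` with `τ₀ := √2·τ̄`), written on the owner's part 1
`NE9FutureProfileRecordPrelim` (p254124) and on `NE9ChannelReadingSharp` (p254636, this lineage: the refuter's removable surcharge F-R4-3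
of `PRICING-NE9.md` v6 — `‖RdAmb (j+n) j s‖ ≤ τ̄·ωⁿ` WITHOUT `√2`).  THE PROOFS ARE THE OWNER's, verbatim up to the constant: this file
GENERALISES his two theorems from the hard-wired `JRec` (`τ₀ = √2·τ̄`) to the injection `injRead (RdAmb …) hτ₀ hω hωh hωωh hRd` built
from the ambient readings with ANY constant `τ₀` for which `hRd : ‖RdAmb (j+n) j s‖ ≤ τ₀·ωⁿ` is supplied (§1–§2), and then
INSTANTIATES at `τ₀ := τ̄` through `NE9ChannelReadingSharp.norm_RdAmb_le_geometric_sharp` (§3) — the END OF RECORD with the room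
`ω̂·r + τ̄·B₀ ≤ θ·r` and every other letter identical to the tree END — and — in a HOME probe only,
since the gate forbids restating a landed theorem — at `τ₀ := √2·τ̄` through the owner's `norm_RdAmb_le_geometric`, recovering the
tree END's statement (junction, §4).  Offered as «(d) a sibling … yours or any leaf's
option» by `t4-ne9-idea-1` gen 6 (`t4/ROUTES-NE9.md` v6.0.1; its scratch kernel `t4/ideate/NE9/lens1-NE9SharpRecordEnd.lean` is a
third, independent engine — not copied here) and announced as OFFER (b) in this lineage's LANDED line for p254636.

HONEST FRAMING (T4-DAG PAGE 1).  Rung (B)+1 of the FINITE-VOLUME T⁴ programme — NOT infinite volume, NOT a mass gap, NOT the Clay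
problem.  NE9 (`T4OutputRate.NE9` ∧ `FadingMemory`) is a cell NEW ESTIMATE, NOT PRINTED in [I] = [Balaban1987RG1] (CMP **109**), [II] =
[Balaban1988RG2Cluster] (CMP **116**), and NOT PROVED for Bałaban's E^{(j)}: the theorems below are «NE9 ⇐ the named binders» for an
ABSTRACT functional `E` carrying EXACTLY the END of record's structural binders plus ONE complex slice map `ΦY` with the three displayed
clauses (Φ-holo) ∕ (Φ-size) ∕ (Φ-real) — the INSTANCE ((R-0)[scope] on the inflated box through (♮)(♭)(δ), and the reality clause,
owner's D4) — and the model O-NE9-1 (wall W1) UNTOUCHED; spine PROVED 0∕9.  HONEST DEPENDENCY (cell line, verbatim): continuum YM on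
T⁴ ⇐ BetaPertH ∧ nine spine estimates (0/9 proved); BetaPertH ⇐ (D1) ∧ (D4) ∧ CAP+tail; G-an2-4 gates asym, D1 and NE2/3/4.
`FlowStep.BetaPertH`, (B), (B^μ) do not occur.  Bookkeeping and composition over the generic kernels (`NE9EarleHamiltonChain`, K2♭
`NE9FutureProfileStep`∕`End`); no `def`, no Prop-valued definition; [I]∕[II] for TYPES∕loci only (ABSOLUTE RULE).  0 sorry.

* §1 **`orbit_of_record_injRead`** — the owner's `orbit_of_record` for the injection `injRead (RdAmb …) hτ₀ … hRd` with ANY `τ₀ ≥ 0`: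
  (i) `|E g U X| ≤ e^{−κd(X)}·B₀` on creation steps `≤ k`; (ii) the slice coordinate IS `τ₀ • embR κ (E g)↾k`; (iii) the profile
  coordinate at `(n, s)` IS `ω̂⁻ⁿ •` the record's weighted reading of `T (k+n) s (truncScale k (E g))`; room `ω̂·r + τ₀·B₀ ≤ θ·r`.
* §2 **`ne9_and_fadingMemory_of_holoSlice_injRead`** — the owner's END for ANY `τ₀ > 0` with `hRd` (τ₀ cancels from the moduli).
* §3 **`ne9_and_fadingMemory_of_holoSlice_sharp`** — `τ₀ := τ̄`: the END OF RECORD with ROOM `ω̂·r + τ̄·B₀ ≤ θ·r` (F-R4-3 gone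
  from the END: in the refuter's letters θ_dock(S) = θ(S), alive iff S > 1).
* §4 (junction, recorded not re-declared): the tree END is §2 at `τ₀ := √2·τ̄` (HOME probe; `dedup.landed` forbids a restatement).
DISGUISE TEST: an abstract functional with displayed binders, one slice map, one injection; no carriers of Bałaban's; not NE9.
WHAT THIS DOES NOT DO: discharge (Φ-holo)∕(Φ-size)∕(Φ-real) (owner's D4 `NE9HoloSliceOfPencil`), touch W1, or improve the RATE
(the ♯-rate `θ` with prefactor `1∕(1−θ²)` is `t4-ne9-idea-1`'s R4♯, kernel to the tree via leaf-03's M1–M3; it will be a corollary of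
§2's shape with the chain supplied externally, not of this file).

References (TYPES ∕ loci only): [Balaban1987RG1] T. Bałaban, CMP **109** (1987) 249–301 — (0.23) p. 256 (no term before the first
step), (2.13) p. 268, (1.18) p. 263; [Balaban1988RG2Cluster] T. Bałaban, CMP **116** (1988) 1–22 — (1.36) p. 9.  Summits-side NEW work
(LEAN PLACEMENT RULE); imports the owner's `NE9FutureProfileRecordPrelim` and this lineage's `NE9ChannelReadingSharp` BY NAME; modifies
nothing; 0 sorry.  Value = the END of record's room constant restored to `τ̄` (a displayed hypothesis weakened), NOT summit progress.
-/

noncomputable section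

namespace Summit.QuantumFields.BalabanUV.T4Continuum.NE9FutureProfileEndOfRecordSharp

open Metric Set
open scoped BigOperators ENNReal
open Literature.MathematicalPhysics.QuantumFieldTheory.Balaban1983to89
open Literature.MathematicalPhysics.QuantumFieldTheory.Balaban1983to89.T4OutputRate
open Literature.MathematicalPhysics.QuantumFieldTheory.Balaban1983to89.T4HistoryLipschitzRecursion
open Literature.MathematicalPhysics.QuantumFieldTheory.Balaban1983to89.T4HistoryLipschitzOuter
open Summit.QuantumFields.BalabanUV.T4Continuum.NE9EarleHamiltonChain
open Summit.QuantumFields.BalabanUV.T4Continuum.NE9FutureProfileStep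
open Summit.QuantumFields.BalabanUV.T4Continuum.NE9FutureProfileEnd
open Summit.QuantumFields.BalabanUV.T4Continuum.NE9ChannelRealLinear
open Summit.QuantumFields.BalabanUV.T4Continuum.NE9SliceSpaceOfRecord
open Summit.QuantumFields.BalabanUV.T4Continuum.NE9ChannelReadingOfRecord
open Summit.QuantumFields.BalabanUV.T4Continuum.NE9ChannelReadingSharp
open Summit.QuantumFields.BalabanUV.T4Continuum.NE9TableReading
open Summit.QuantumFields.BalabanUV.T4Continuum.NE9FutureProfileRecordPrelim

variable {C : Carriers} {Bg ι : Type}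

section Record

variable [Nonempty ι] {E : Functional C Bg} {W : Set (ℕ → ℝ)} {Adm : Set (Bg → C.Dom → ℝ)}
  {T : ℕ → (ℕ → ℝ) → (Bg → C.Dom → ℝ) → ι → ℝ} {Ψ : ℕ → ℝ → (ι → ℝ) → Bg → C.Dom → ℝ}
  {κ : ℝ} {wt : ℕ → ι → ℝ} {τ : ℕ → ℕ → ℝ} {τbar ω ωh : ℝ}

/-! ## §1 The orbit identification for an arbitrary reading constant -/

/-- **THE ORBIT OF RECORD, ARBITRARY READING CONSTANT** (the owner's `NE9FutureProfileEndOfRecord.orbit_of_record` with the injection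
`injRead (RdAmb …) hτ₀ hω hωh hωωh hRd` for ANY `τ₀ ≥ 0` carrying `hRd : ‖RdAmb (j+n) j s‖ ≤ τ₀·ωⁿ`, instead of `JRec` = the case
`τ₀ = √2·τ̄`; proof = the owner's, by induction on the step).  Hypotheses: the END of record's structural binders, base-free histories
(`h0`, printed structure [I] (0.23) p. 256), (Φ-size), (Φ-real), and the room `ω̂·r + τ₀·B₀ ≤ θ·r`.  Conclusions for `g ∈ W` and
every `k`: (i) `|E g U X| ≤ e^{−κd(X)}·B₀` on creation steps `≤ k`; (ii) the slice coordinate of the orbit IS `τ₀ • embR κ (E g)↾k`;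
(iii) the profile coordinate at `(n, s)` IS `ω̂⁻ⁿ •` the record's weighted reading of `T (k+n) s (truncScale k (E g))`. [folklore] -/
theorem orbit_of_record_injRead (h0 : ∀ g ∈ W, ∀ (U : Bg) (X : C.Dom), C.scale X = 0 → E g U X = 0)
    (hAdm : AdmissibleTerms E W Adm) (hres : AdmRestrict Adm) (hadd : ChannelAdditive Adm T) (hloc : ChannelLocal Adm T)
    (hstep : ChannelSizeAtStepNN Adm T κ wt τ) (hfac : Factorises E W T Ψ)
    (hsmul : ∀ (c : ℝ), ∀ H ∈ Adm, c • H ∈ Adm) (hne : Adm.Nonempty) (hwt : ∀ m y, 0 < wt m y)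
    (hτ : ∀ k j, j ≤ k → 0 ≤ τ k j ∧ τ k j ≤ τbar * ω ^ (k - j)) (hω : 0 ≤ ω) (hωh : 0 < ωh) (hωωh : ω ≤ ωh)
    {τ₀ : ℝ} (hτ₀ : 0 ≤ τ₀)
    (hRd : ∀ (j n : ℕ), ∀ s ∈ W,
      ‖RdAmb (κ := κ) hadd hres hstep hAdm.2 hsmul hne hwt (τ_nonneg hτ) (j + n) j s‖ ≤ τ₀ * ω ^ n)
    {ΦY : ℕ → ℝ → lp (fun _ : ι => ℂ) ∞ → lp (fun _ : Bg × C.Dom => ℂ) ∞} {r B₀ θ : ℝ} (hr : 0 < r)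
    (hB₀ : 0 ≤ B₀) (hθ1 : θ < 1)
    (hΦb : ∀ k, ∀ g ∈ W, MapsTo (ΦY k (g k)) (ball (0 : lp (fun _ : ι => ℂ) ∞) r) (closedBall 0 B₀))
    (hreal : ∀ k, ∀ g ∈ W, ∀ s ∈ W, reading (wt k) (T k s (E g)) ∈ ball (0 : lp (fun _ : ι => ℂ) ∞) r →
      ∀ (U : Bg) (X : C.Dom), (ΦY k (s k) (reading (wt k) (T k s (E g))) : Bg × C.Dom → ℂ) (U, X) =
        ((Real.exp (κ * C.d X) * restrictScale (k + 1) (Ψ k (s k) (T k s (E g))) U X : ℝ) : ℂ))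
    (hroom : ωh * r + τ₀ * B₀ ≤ θ * r) {g : ℕ → ℝ} (hg : g ∈ W) (k : ℕ) :
    (∀ (U : Bg) (X : C.Dom), C.scale X ≤ k → |E g U X| ≤ Real.exp (-(κ * C.d X)) * B₀) ∧
      (emb W ΦY (injRead (RdAmb (κ := κ) hadd hres hstep hAdm.2 hsmul hne hwt (τ_nonneg hτ)) hτ₀ hω hωh hωωh hRd)
          τ₀ ωh 0 k g).1 = ((τ₀ : ℝ) : ℂ) • embR κ (restrictScale k (E g)) ∧
      (∀ (n : ℕ) (s : ℕ → ℝ) (hs : s ∈ W),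
        (emb W ΦY (injRead (RdAmb (κ := κ) hadd hres hstep hAdm.2 hsmul hne hwt (τ_nonneg hτ)) hτ₀ hω hωh hωωh hRd)
            τ₀ ωh 0 k g).2 ⟨n, ⟨s, hs⟩⟩ =
          (((ωh⁻¹ : ℝ) : ℂ) ^ n) • reading (wt (k + n)) (T (k + n) s (truncScale k (E g)))) := by
  set J := injRead (W := W) (RdAmb (κ := κ) hadd hres hstep hAdm.2 hsmul hne hwt (τ_nonneg hτ)) hτ₀ hω hωh hωωh hRd
    with hJdef
  have hJ : ∀ k, ‖J k‖ ≤ τ₀ := fun k => norm_injRead_le _ hτ₀ hω hωh hωωh hRd k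
  have hsum : ChannelStepSum Adm T := channelStepSum_of_local hres hadd hloc
  have hEg : E g ∈ Adm := hAdm.1 g hg
  have hθr : θ * r < r := by nlinarith
  have hd : ∀ k, ‖emb W ΦY J τ₀ ωh 0 k g‖ ≤ θ * r := fun k =>
    norm_emb_le (fun k g hg => mapsTo_step hτ₀ hωh.le hΦb hJ hroom k hg) hθr
      (by rw [norm_zero]; nlinarith [mul_nonneg hτ₀ hB₀, mul_pos hωh hr]) k hg
  induction k with
  | zero =>
    have hz : truncScale 0 (E g) = 0 := truncScale_zero_eq_zero (h0 g hg)
    have hz' : restrictScale 0 (E g) = 0 := by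
      funext U X
      by_cases hX : C.scale X = 0
      · rw [restrictScale_of_eq _ hX, h0 g hg U X hX, Pi.zero_apply, Pi.zero_apply]
      · rw [restrictScale_of_ne _ hX, Pi.zero_apply, Pi.zero_apply]
    refine ⟨fun U X hX => ?_, ?_, fun n s hs => ?_⟩
    · rw [h0 g hg U X (Nat.le_zero.mp hX), abs_zero]; positivity
    · rw [emb_zero, Prod.fst_zero, hz', embR_zero, smul_zero]
    · have hT0 : T (0 + n) s 0 = 0 := funext fun y => channel_zero hadd hEg _ s y
      rw [emb_zero, Prod.snd_zero, BoundedContinuousFunction.coe_zero, Pi.zero_apply, hz, hT0,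
        reading_zero_of_pos (hwt _), smul_zero]
  | succ k ih =>
    obtain ⟨ha, hb, hc⟩ := ih
    set e := emb W ΦY J τ₀ ωh 0 k g with hedef
    -- F1: the profile coordinate at `(0, s)` is the record's table
    have hF1 : ∀ (s : ℕ → ℝ) (hs : s ∈ W), e.2 ⟨0, ⟨s, hs⟩⟩ = reading (wt k) (T k s (E g)) := by
      intro s hs
      have h1 := hc 0 s hs
      have hT : T (k + 0) s (truncScale k (E g)) = T k s (E g) := by
        funext y; rw [Nat.add_zero]; exact (hloc k s (E g) hEg y).symm
      rw [pow_zero, one_smul, hT] at h1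
      simpa only [Nat.add_zero] using h1
    -- F2: those tables lie in the open `r`-ball
    have hF2 : ∀ (s : ℕ → ℝ) (hs : s ∈ W), reading (wt k) (T k s (E g)) ∈ ball (0 : lp (fun _ : ι => ℂ) ∞) r := by
      intro s hs
      rw [← hF1 s hs, mem_ball_zero_iff]
      exact lt_of_le_of_lt ((e.2.norm_coe_le_norm _).trans ((norm_snd_le e).trans (hd k))) hθr
    -- the new slice of the record, and its identification
    set S : Bg → C.Dom → ℝ := restrictScale (k + 1) (E g) with hSdef
    have hSΨ : restrictScale (k + 1) (Ψ k (g k) (T k g (E g))) = S := by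
      funext U X
      by_cases hX : C.scale X = k + 1
      · rw [hSdef, restrictScale_of_eq _ hX, restrictScale_of_eq _ hX, hfac g hg k U X hX]
      · rw [hSdef, restrictScale_of_ne _ hX, restrictScale_of_ne _ hX]
    have hnew : newSlice W ΦY J τ₀ ωh 0 k g hg = ΦY k (g k) (reading (wt k) (T k g (E g))) := by
      rw [newSlice, ← hedef, hF1 g hg]
    have hcoordS := eq_embR_of_coord (κ := κ) (G := ΦY k (g k) (reading (wt k) (T k g (E g)))) (H := S)
      (fun U X => by rw [hreal k g hg g hg (hF2 g hg) U X, hSΨ])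
    have hGB : ‖ΦY k (g k) (reading (wt k) (T k g (E g)))‖ ≤ B₀ := mem_closedBall_zero_iff.mp (hΦb k g hg (hF2 g hg))
    have hSb : ∀ (U : Bg) (X : C.Dom), |S U X| ≤ Real.exp (-(κ * C.d X)) * B₀ := fun U X =>
      (hcoordS.1 U X).trans (mul_le_mul_of_nonneg_left hGB (Real.exp_pos _).le)
    have hSb' : ∀ (U : Bg) (X : C.Dom), C.scale X = k + 1 → |E g U X| ≤ Real.exp (-(κ * C.d X)) * B₀ := by
      intro U X hX
      have h := hSb U X
      rwa [hSdef, restrictScale_of_eq _ hX] at h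
    -- (i)
    have ha' : ∀ (U : Bg) (X : C.Dom), C.scale X ≤ k + 1 → |E g U X| ≤ Real.exp (-(κ * C.d X)) * B₀ := by
      intro U X hX
      rcases Nat.lt_or_eq_of_le hX with hlt | heq
      · exact ha U X (Nat.lt_succ_iff.mp hlt)
      · exact hSb' U X heq
    refine ⟨ha', ?_, fun n s hs => ?_⟩
    · -- (ii)
      rw [emb_succ_fst _ k hg, hnew, hcoordS.2]
    · -- (iii)
      have hm : k + (n + 1) = k + 1 + n := by omega
      have hTadd : T (k + 1 + n) s (truncScale (k + 1) (E g)) =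
          T (k + 1 + n) s (truncScale k (E g)) + T (k + 1 + n) s S := by
        funext y
        rw [truncScale_succ_eq, Pi.add_apply]
        exact channel_add hadd hAdm.2 hsmul (hres.2 _ hEg k) (hres.1 _ hEg (k + 1)) _ s y
      have hb1 := abs_channel_trunc_le hres hsum hstep hEg hB₀ ha (k + 1 + n) s
      have hb2 := abs_channel_restrict_le hres hsum hstep hEg hB₀ hSb' (k + 1 + n) s
      have hRd' : RdAmb (κ := κ) hadd hres hstep hAdm.2 hsmul hne hwt (τ_nonneg hτ) (k + 1 + n) (k + 1) s (embR κ S) =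
          reading (wt (k + 1 + n)) (T (k + 1 + n) s S) := by
        refine eq_reading_of_apply (hwt _) hb2 fun y => ?_
        rw [RdAmb_embR_apply (Nat.le_add_right _ _) s (hres.1 _ hEg (k + 1)) hSb y,
          NE9MarginalProjection.restrictScale_restrictScale_self]
      rw [emb_succ_snd_apply _ k hg, ← hedef, hc (n + 1) s hs, hnew, hcoordS.2]
      show (ωh : ℂ) • _ + injRead _ _ _ _ _ _ k (embR κ S) ⟨n, ⟨s, hs⟩⟩ = _
      rw [injRead_apply, hRd', hm, hTadd, reading_add_of_bound (hwt _) hb1 hb2, smul_add, smul_smul]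
      congr 1
      have hne' : (ωh : ℂ) ≠ 0 := by exact_mod_cast hωh.ne'
      rw [Complex.ofReal_inv, pow_succ, mul_comm (ωh : ℂ), mul_assoc, inv_mul_cancel₀ hne', mul_one]

/-! ## §2 THE END OF ROUTE R4 AT THE RECORD, arbitrary reading constant -/

/-- **ROUTE R4's END OF RECORD, ARBITRARY READING CONSTANT** (the owner's `ne9_and_fadingMemory_of_holoSlice` with `JRec` ↦
`injRead (RdAmb …) hτ₀.le … hRd`, any `τ₀ > 0` with `hRd : ‖RdAmb (j+n) j s‖ ≤ τ₀·ωⁿ`; proof = the owner's: K2♭'s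
`ne9_and_fadingMemory_futureInfluence_EH` on the ambient slice space, `coord := τ₀⁻¹ • coord κ U X`, `e₀ := 0`, `hΦlast` from
`LastCouplingLipschitz` through (Φ-real) and `embR`, `hE` from §1 — `τ₀` CANCELS from the moduli and survives only in the room
`ω̂·r + τ₀·B₀ ≤ θ·r`).  «NE9 ⇐ the named binders»: (Φ-holo)∕(Φ-size)∕(Φ-real) are the INSTANCE, W1 the model — untouched.
[cite: Balaban1987RG1, (2.13) p.268; Balaban1988RG2Cluster, (1.36) p.9] -/
theorem ne9_and_fadingMemory_of_holoSlice_injRead (h0 : ∀ g ∈ W, ∀ (U : Bg) (X : C.Dom), C.scale X = 0 → E g U X = 0)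
    (hAdm : AdmissibleTerms E W Adm) (hres : AdmRestrict Adm) (hadd : ChannelAdditive Adm T) (hloc : ChannelLocal Adm T)
    (hstep : ChannelSizeAtStepNN Adm T κ wt τ) (hfac : Factorises E W T Ψ) {lam : ℕ → ℝ}
    (hlast : LastCouplingLipschitz E W T Ψ κ lam)
    (hsmul : ∀ (c : ℝ), ∀ H ∈ Adm, c • H ∈ Adm) (hne : Adm.Nonempty) (hwt : ∀ m y, 0 < wt m y)
    (hτ : ∀ k j, j ≤ k → 0 ≤ τ k j ∧ τ k j ≤ τbar * ω ^ (k - j)) (hω : 0 ≤ ω) (hωh : 0 < ωh) (hωωh : ω ≤ ωh)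
    {τ₀ : ℝ} (hτ₀pos : 0 < τ₀)
    (hRd : ∀ (j n : ℕ), ∀ s ∈ W,
      ‖RdAmb (κ := κ) hadd hres hstep hAdm.2 hsmul hne hwt (τ_nonneg hτ) (j + n) j s‖ ≤ τ₀ * ω ^ n)
    {ΦY : ℕ → ℝ → lp (fun _ : ι => ℂ) ∞ → lp (fun _ : Bg × C.Dom => ℂ) ∞} {r B₀ θ ℓ : ℝ} (hr : 0 < r)
    (hB₀ : 0 ≤ B₀) (hθ0 : 0 < θ) (hθ1 : θ < 1) (hℓ : 0 ≤ ℓ)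
    (hΦd : ∀ k, ∀ g ∈ W, DifferentiableOn ℂ (ΦY k (g k)) (ball (0 : lp (fun _ : ι => ℂ) ∞) r))
    (hΦb : ∀ k, ∀ g ∈ W, MapsTo (ΦY k (g k)) (ball (0 : lp (fun _ : ι => ℂ) ∞) r) (closedBall 0 B₀))
    (hreal : ∀ k, ∀ g ∈ W, ∀ s ∈ W, reading (wt k) (T k s (E g)) ∈ ball (0 : lp (fun _ : ι => ℂ) ∞) r →
      ∀ (U : Bg) (X : C.Dom), (ΦY k (s k) (reading (wt k) (T k s (E g))) : Bg × C.Dom → ℂ) (U, X) =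
        ((Real.exp (κ * C.d X) * restrictScale (k + 1) (Ψ k (s k) (T k s (E g))) U X : ℝ) : ℂ))
    (hroom : ωh * r + τ₀ * B₀ ≤ θ * r) (hlam : ∀ k, lam k ≤ ℓ) :
    NE9 E W κ (prodModuli (2 / (1 - θ) * ℓ) fun _ => 2 * θ / (1 + θ)) ∧
      FadingMemory (2 / (1 - θ) * ℓ / (2 * θ / (1 + θ))) (2 * θ / (1 + θ))
        (prodModuli (2 / (1 - θ) * ℓ) fun _ => 2 * θ / (1 + θ)) := by
  have hτ₀ : 0 ≤ τ₀ := hτ₀pos.le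
  have hτ₀ne : (τ₀ : ℂ) ≠ 0 := by exact_mod_cast hτ₀pos.ne'
  set J := injRead (W := W) (RdAmb (κ := κ) hadd hres hstep hAdm.2 hsmul hne hwt (τ_nonneg hτ)) hτ₀ hω hωh hωωh hRd
    with hJdef
  have hJ : ∀ k, ‖J k‖ ≤ τ₀ := fun k => norm_injRead_le _ hτ₀ hω hωh hωωh hRd k
  have hθr : θ * r < r := by nlinarith
  -- the orbit identification, per history
  have horb := fun (g : ℕ → ℝ) (hg : g ∈ W) (k : ℕ) =>
    orbit_of_record_injRead h0 hAdm hres hadd hloc hstep hfac hsmul hne hwt hτ hω hωh hωωh hτ₀ hRd hr hB₀ hθ1 hΦb hreal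
      hroom hg k
  -- the profile coordinate at `(0, s)` is the record's table, inside the ball
  have hF1 : ∀ g (hg : g ∈ W) (k : ℕ) (s : ℕ → ℝ) (hs : s ∈ W),
      (emb W ΦY J τ₀ ωh 0 k g).2 ⟨0, ⟨s, hs⟩⟩ = reading (wt k) (T k s (E g)) := by
    intro g hg k s hs
    have h1 := (horb g hg k).2.2 0 s hs
    have hT : T (k + 0) s (truncScale k (E g)) = T k s (E g) := by
      funext y; rw [Nat.add_zero]; exact (hloc k s (E g) (hAdm.1 g hg) y).symm
    rw [pow_zero, one_smul, hT] at h1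
    simpa only [Nat.add_zero] using h1
  have hF2 : ∀ g (hg : g ∈ W) (k : ℕ) (s : ℕ → ℝ) (hs : s ∈ W),
      reading (wt k) (T k s (E g)) ∈ ball (0 : lp (fun _ : ι => ℂ) ∞) r := by
    intro g hg k s hs
    rw [← hF1 g hg k s hs, mem_ball_zero_iff]
    exact lt_of_le_of_lt (((emb W ΦY J τ₀ ωh 0 k g).2.norm_coe_le_norm _).trans
      ((norm_snd_le _).trans (norm_emb_le (fun k g hg => mapsTo_step hτ₀ hωh.le hΦb hJ hroom k hg) hθr
        (by rw [norm_zero]; nlinarith [mul_nonneg hτ₀ hB₀, mul_pos hωh hr]) k hg))) hθr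
  -- the slice map at the record's tables is the embedded real slice
  have hemb : ∀ g (hg : g ∈ W) (k : ℕ) (s : ℕ → ℝ) (hs : s ∈ W),
      (∀ (U : Bg) (X : C.Dom), |restrictScale (k + 1) (Ψ k (s k) (T k s (E g))) U X| ≤ Real.exp (-(κ * C.d X)) * B₀) ∧
      ΦY k (s k) (reading (wt k) (T k s (E g))) = embR κ (restrictScale (k + 1) (Ψ k (s k) (T k s (E g)))) := by
    intro g hg k s hs
    have h := eq_embR_of_coord (κ := κ) (hreal k g hg s hs (hF2 g hg k s hs))
    have hGB : ‖ΦY k (s k) (reading (wt k) (T k s (E g)))‖ ≤ B₀ :=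
      mem_closedBall_zero_iff.mp (hΦb k s hs (hF2 g hg k s hs))
    exact ⟨fun U X => (h.1 U X).trans (mul_le_mul_of_nonneg_left hGB (Real.exp_pos _).le), h.2⟩
  -- K2♭'s END
  have key := ne9_and_fadingMemory_futureInfluence_EH (W := W) (Φ := ΦY) (J := J) (τ₀ := τ₀) (ωh := ωh) E 0
    (fun U X => ((τ₀⁻¹ : ℝ) : ℂ) • coord κ U X) (κ := κ) (cY := τ₀⁻¹) (lam := fun k => max (lam k) 0) hr hθ0 hθ1 hℓ
    (inv_nonneg.mpr hτ₀) hτ₀ hωh.le hΦd hΦb hJ hroom (by rw [norm_zero]; nlinarith) ?_ (fun k => max_le (hlam k) hℓ) ?_ ?_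
  · have hc : τ₀⁻¹ * (2 / (1 - θ)) * (τ₀ * ℓ) = 2 / (1 - θ) * ℓ := by field_simp
    rwa [hc] at key
  · -- hΦlast from `LastCouplingLipschitz`
    intro k g hg g' hg'
    rw [hF1 g hg k g hg, hF1 g hg k g' hg', (hemb g hg k g hg).2, (hemb g hg k g' hg').2,
      ← embR_sub (hemb g hg k g hg).1 (hemb g hg k g' hg').1]
    refine norm_embR_le (mul_nonneg (le_max_right _ _) (abs_nonneg _)) fun U X => ?_
    rw [Pi.sub_apply, Pi.sub_apply]
    by_cases hX : C.scale X = k + 1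
    · rw [restrictScale_of_eq _ hX, restrictScale_of_eq _ hX]
      exact (hlast g hg g' hg' k U X hX).trans (mul_le_mul_of_nonneg_left
        (mul_le_mul_of_nonneg_right (le_max_left _ _) (abs_nonneg _)) (Real.exp_pos _).le)
    · rw [restrictScale_of_ne _ hX, restrictScale_of_ne _ hX, sub_zero, abs_zero]; positivity
  · -- hcoord
    intro U X
    rw [norm_smul, Complex.norm_real, Real.norm_of_nonneg (inv_nonneg.mpr hτ₀)]
    exact mul_le_mul_of_nonneg_left (norm_coord_le κ U X) (inv_nonneg.mpr hτ₀)
  · -- hE from the orbit identification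
    intro g hg U X
    rcases Nat.eq_zero_or_eq_succ_pred (C.scale X) with hX | hX
    · rw [hX, emb_zero, Prod.fst_zero, map_zero, Complex.zero_re, h0 g hg U X hX]
    · set k := (C.scale X).pred with hk
      rw [hX, (horb g hg (k + 1)).2.1, _root_.smul_apply, map_smul, smul_smul, Complex.ofReal_inv,
        inv_mul_cancel₀ hτ₀ne, one_smul,
        coord_embR_re (N := B₀) (fun U X => ?_), restrictScale_of_eq _ hX]
      by_cases h' : C.scale X = k + 1
      · rw [restrictScale_of_eq _ h']; exact (horb g hg (k + 1)).1 U X h'.le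
      · rw [restrictScale_of_ne _ h', abs_zero]; positivity

/-! ## §3 THE `√2`-FREE END OF RECORD (`τ₀ := τ̄`, F-R4-3 removed) -/

/-- **ROUTE R4's END OF RECORD WITH THE ROOM `ω̂·r + τ̄·B₀ ≤ θ·r`** — the tree END `NE9FutureProfileEndOfRecord.
ne9_and_fadingMemory_of_holoSlice` with its room hypothesis's `Real.sqrt 2 * τbar` replaced by `τbar`, every other letter identical:
§2 at `τ₀ := τ̄` with `hRd := NE9ChannelReadingSharp.norm_RdAmb_le_geometric_sharp` (the refuter's F-R4-3 surcharge is thereby absent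
from the END of record: in `PRICING-NE9.md` v6's letters θ_dock(S) = θ(S), alive iff S > 1).  «NE9 ⇐ the named binders».
[cite: Balaban1987RG1, (2.13) p.268; Balaban1988RG2Cluster, (1.36) p.9] -/
theorem ne9_and_fadingMemory_of_holoSlice_sharp (h0 : ∀ g ∈ W, ∀ (U : Bg) (X : C.Dom), C.scale X = 0 → E g U X = 0)
    (hAdm : AdmissibleTerms E W Adm) (hres : AdmRestrict Adm) (hadd : ChannelAdditive Adm T) (hloc : ChannelLocal Adm T)
    (hstep : ChannelSizeAtStepNN Adm T κ wt τ) (hfac : Factorises E W T Ψ) {lam : ℕ → ℝ}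
    (hlast : LastCouplingLipschitz E W T Ψ κ lam)
    (hsmul : ∀ (c : ℝ), ∀ H ∈ Adm, c • H ∈ Adm) (hne : Adm.Nonempty) (hwt : ∀ m y, 0 < wt m y)
    (hτ : ∀ k j, j ≤ k → 0 ≤ τ k j ∧ τ k j ≤ τbar * ω ^ (k - j)) (hτbar : 0 < τbar) (hω : 0 ≤ ω) (hωh : 0 < ωh)
    (hωωh : ω ≤ ωh) {ΦY : ℕ → ℝ → lp (fun _ : ι => ℂ) ∞ → lp (fun _ : Bg × C.Dom => ℂ) ∞} {r B₀ θ ℓ : ℝ} (hr : 0 < r)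
    (hB₀ : 0 ≤ B₀) (hθ0 : 0 < θ) (hθ1 : θ < 1) (hℓ : 0 ≤ ℓ)
    (hΦd : ∀ k, ∀ g ∈ W, DifferentiableOn ℂ (ΦY k (g k)) (ball (0 : lp (fun _ : ι => ℂ) ∞) r))
    (hΦb : ∀ k, ∀ g ∈ W, MapsTo (ΦY k (g k)) (ball (0 : lp (fun _ : ι => ℂ) ∞) r) (closedBall 0 B₀))
    (hreal : ∀ k, ∀ g ∈ W, ∀ s ∈ W, reading (wt k) (T k s (E g)) ∈ ball (0 : lp (fun _ : ι => ℂ) ∞) r →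
      ∀ (U : Bg) (X : C.Dom), (ΦY k (s k) (reading (wt k) (T k s (E g))) : Bg × C.Dom → ℂ) (U, X) =
        ((Real.exp (κ * C.d X) * restrictScale (k + 1) (Ψ k (s k) (T k s (E g))) U X : ℝ) : ℂ))
    (hroom : ωh * r + τbar * B₀ ≤ θ * r) (hlam : ∀ k, lam k ≤ ℓ) :
    NE9 E W κ (prodModuli (2 / (1 - θ) * ℓ) fun _ => 2 * θ / (1 + θ)) ∧
      FadingMemory (2 / (1 - θ) * ℓ / (2 * θ / (1 + θ))) (2 * θ / (1 + θ))
        (prodModuli (2 / (1 - θ) * ℓ) fun _ => 2 * θ / (1 + θ)) :=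
  ne9_and_fadingMemory_of_holoSlice_injRead h0 hAdm hres hadd hloc hstep hfac hlast hsmul hne hwt hτ hω hωh hωωh hτbar
    (fun j n s _ => norm_RdAmb_le_geometric_sharp (τ_geom hτ) j n s) hr hB₀ hθ0 hθ1 hℓ hΦd hΦb hreal hroom hlam

/-! ## §4 Junction (recorded, not re-declared)

The tree END `NE9FutureProfileEndOfRecord.ne9_and_fadingMemory_of_holoSlice` (room `ω̂·r + (√2·τ̄)·B₀ ≤ θ·r`) IS §2 at
`τ₀ := Real.sqrt 2 * τbar` with `hRd := norm_RdAmb_le_geometric (τ_geom hτ)` — checked by `exact` in this lineage's HOME probe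
`t4/b2b-balaban-t4-ne9-formalise-leaf-05/g46/junction/ProbeEndSharp_sqrt2Junction.rc0.lean` (the gate's `dedup.landed` rule forbids
re-declaring a landed statement, so the instance is not a theorem of this file; consumers of the `√2` END keep importing the owner's). -/

end Record

end Summit.QuantumFields.BalabanUV.T4Continuum.NE9FutureProfileEndOfRecordSharp

end
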